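import Summits.QuantumFields.YangMills.Theorems.LevelShiftBootstrapHistoryTailOfLocalStability
import Summits.QuantumFields.YangMills.Theorems.SmallFieldWideningLargeFieldMassRefinementTailOfHeightTail

/-!
# Route `SmallFieldWidening`, crux r3 `LargeFieldMassRefinementTail` (stmt-QuantumFields-22884), line `birth` — CERTIFICATE:
# r3 ⇐ `LocalUnitStabilityL` (crux of the sibling route `LevelShiftBootstrap`, stmt-QuantumFields-27016), by the level-shift bootstrap

Width seat `ym-line-sfw-p2-w3` g22 (home cell `ym-idea-1`), `--supports stmt-QuantumFields-22884`; the stub `stub_unitTopSummable`, the crux and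
rung R3 stay OPEN.

WHAT.  ★ `largeFieldMassRefinementTail_of_localUnitStabilityL : LocalUnitStabilityL → LargeFieldMassRefinementTail`.  The bootstrap proved for the
support item `HistoryTailOfLocalStability` (stmt-QuantumFields-26949, `HistoryTailOfLocalStability.perPlaquette_tail_of_localUnitStabilityL`) delivers,
for every block size, a profile and a threshold `γ₁ ≤ 1` such that every family at every `0 < γ ≤ γ₁` has a Gaussian per-plaquette large-field tail
`Gibbs_K{θ(K−j) ≤ |Ū^{j}(∂q) − 1|} ≤ C·β_{K−j}^A·e^{−a p(g_{K−j})²}` at EVERY height, uniformly in the run (constants per family) — exactly the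
hypothesis of the landed `LargeFieldMassRefinementTailOfHeightTail.largeFieldMassRefinementTail_of_perPlaquette`.  So a NEW sufficient feeder of r3
is on record next to `FirstExitWindowTailL` / 2′χ / `IntCoreRec` / `CappedCoarseStiffnessL` / `TwoSidedTailL ∧ TowerTailL`: the LOCAL, CONDITIONAL,
one-event cross-cut-off stability `LocalUnitStabilityL` (volume-polynomial, `p`-linear slack) — the K-uniformity that r3 needs is produced by the
induction, not assumed.

HONEST FRAMING.  Conditional certificate; `LocalUnitStabilityL` is open (XL: volume-uniform decoupling of a unit event from the extensive
log-density difference); rung R3 (`YM3TorusSU2`) is a RECORD rung — no summit, no Clay claim; the Yang–Mills mass gap is NOT proved by any of this.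
No `def`, no `sorry`.

References: C. King, CMP **102** (1986) 649–677 [King1986] (Thm 3.4 p.656); T. Bałaban, CMP **102** (1985) 255–275 [Balaban1985UV3] ((7) p.257,
(71) p.273).
-/

set_option autoImplicit false

noncomputable section

open Literature.MathematicalPhysics.QuantumFieldTheory
open Literature.MathematicalPhysics.QuantumFieldTheory.Balaban1983to89
open Literature.MathematicalPhysics.QuantumFieldTheory.Balaban1983to89.T3ContinuumYM3Torus
open Literature.MathematicalPhysics.QuantumFieldTheory.Balaban1983to89.T3UnitScaleTilt
open Literature.MathematicalPhysics.QuantumFieldTheory.Balaban1983to89.T3UnitLawDensityEML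

namespace Summit.QuantumFields.YangMills.Theorems.LargeFieldMassRefinementTailOfLocalUnitStability

/-- ★ **r3 ⇐ `LocalUnitStabilityL`** (module docstring): the local cross-cut-off stability of one unit-plaquette event, bootstrapped along the level
shift, gives the K-uniform large-field mass with a vanishing refinement tail. [cite: King1986, Thm 3.4 (3.9)-(3.13) p.656; Balaban1985UV3, (71) p.273] -/
theorem largeFieldMassRefinementTail_of_localUnitStabilityL
    (hS : Summit.QuantumFields.YangMills.Theses.LevelShiftBootstrap.LocalUnitStabilityL) :
    Summit.QuantumFields.YangMills.Theses.SmallFieldWidening.LargeFieldMassRefinementTail :=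
  LargeFieldMassRefinementTailOfHeightTail.largeFieldMassRefinementTail_of_perPlaquette fun L => by
    obtain ⟨b₀, P, γ₁, -, -, hb₀, hP2, hγ₁, hγ₁1, H⟩ :=
      HistoryTailOfLocalStability.perPlaquette_tail_of_localUnitStabilityL hS L 0 0
    refine ⟨b₀, (P : ℝ), γ₁, hb₀, hP2, hγ₁, hγ₁1, fun F γ hFL hγ hγle => ?_⟩
    obtain ⟨C, A, a, hC, ha, hfin⟩ := H F γ hFL hγ hγle
    exact ⟨C, A, a, hC, ha, fun K j _ hjK p => hfin K j hjK p⟩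

/-- **K2-L ⇐ `LocalUnitStabilityL`** (the parent crux `UnitScaleTilt.HistoryTailL`, stmt-QuantumFields-19936, whose body IS the conclusion of the
support item `HistoryTailOfLocalStability` just proved): recorded by name for the parent route's bookkeeping. [cite: King1986, Thm 3.4 (3.9)-(3.13) p.656] -/
theorem historyTailL_of_localUnitStabilityL
    (hS : Summit.QuantumFields.YangMills.Theses.LevelShiftBootstrap.LocalUnitStabilityL) :
    Summit.QuantumFields.YangMills.Theses.UnitScaleTilt.HistoryTailL :=
  HistoryTailOfLocalStability.levelShiftBootstrap_historyTailOfLocalStability_proof hS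

end Summit.QuantumFields.YangMills.Theorems.LargeFieldMassRefinementTailOfLocalUnitStability

end
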